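import Summits.CriticalPhenomena.SAWScalingLimit.Theses.SAWLoopFugacityFlow
import Summits.CriticalPhenomena.SAWScalingLimit.Theorems.SimpleSubseqLimits.Negative.SimpleSubseqLimitsCore
import Literature.Probability.RandomPlanarGeometry.LoewnerRegularCurves
import Literature.Probability.RandomPlanarGeometry.HullSubdomainPullback
import Literature.Probability.RandomPlanarGeometry.CaratheodoryHalfPlaneProofs
import Literature.Probability.RandomPlanarGeometry.RestrictionHullsProofs
import Literature.Probability.RandomPlanarGeometry.RestrictionHullsRiemannProofs
import Literature.Probability.RandomPlanarGeometry.SLEExistenceNeEightHolds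
import Literature.Probability.RandomPlanarGeometry.JordanDomainProofs
import HarnessLib.Audit

/-!
# Line `past-shadowing-costs-halves` — skeleton for the crux `SimpleSubseqLimits`
(stmt-CriticalPhenomena-4982; decl
`Summit.CriticalPhenomena.SAWScalingLimit.Theses.SAWLoopFugacityFlow.SimpleSubseqLimits`, shared
VERBATIM by the routes SAWSteinDefect / SAWTensorRG / SAWFrontierHomotopy)

Crux-plan (round 1, 2026-08-16) of the idea card `Cruxes/SimpleSubseqLimits/Ideas/past-shadowing-costs-halves.md`
(ideator 1; triage r1: pass ×3, merged with `hugging-release` — same lever).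

## The line

The crux says: every subsequential weak limit `ν` of the critical `δℤ²` SAW laws of a Dobrushin
domain is carried by SIMPLE chords `a → b` in `cl D` meeting `∂D` only at `a, b`.  By the landed
negative lemma `Negative.simpleSubseqLimits_iff_core` (p74405) the endpoint and confinement clauses
are FREE, so the crux is `ν`-a.s. (simple ∧ boundary-avoiding).  The line splits this into

* SHAPE (`RangeArc`): `ν`-a.s. the RANGE of the class is a simple arc `a → b` meeting `∂D` only at
  `a, b` — fed by the hull-avoidance VALUES of the limit (`AvoidanceValues`: `ν` and the chordal
  SLE(8/3) law agree on `{range ⊆ cl D'}` for every hull subdomain `D'`; PROVED here from the route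
  items `AvoidanceLimit`, `AvoidancePassage`, `SLEAvoidanceValue` — `avoidanceValues_of_routeItems`)
  plus the filled-set transport (triage F5/S1) = `stub_rangeArc`;
* ORDER (`NoShadowing`): `ν`-a.s. no representative ever TRAVELS ALONG ITS OWN PAST — after a time
  `s₀`, through a stretch of displacement `≥ η`, on the trace of `γ[0, s₀]` at distance `≥ ρ` from
  `γ s₀` (`Shadows`, `shadowEvent`).  This is the card's lever, delivered by a lattice chain:
  `stub_nearReturnBound` (NRB, the INPUT: an unforced inward approach within `r` of a point of the
  own past, observed from distance `≥ C r`, has conditional probability `≤ ½` — the near-return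
  instances of Kemppainen–Smirnov's Condition G2 for the critical SAW, typed DIRECTLY on the
  conditional laws of `SAW.law` with graph-level avoidability in the slit graph and a BOUNDARY-ROOTED
  start, so neither the vacuous-antecedent artefact of stmt-0791 (triage F1) nor the family-transfer
  gap (F4) can occur) → `stub_shadowChain` (THE LEVER: `≍ η/ε` such approaches, anchored at stopping
  times, each costing `½`: `P_δ(ε-near-shadowing) ≤ θ` eventually in `δ`, for boundary-rooted
  starts) → `stub_rootReduction` (interior lattice roots, triage F2/S2) → `stub_limitPassage`
  (open thickenings + portmanteau + `ε → 0`).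
* GLUE (PROVED, no sorry): for `ν`-a.e. class take a LIGHT representative
  (`Curve.exists_light_of_ne`); no shadowing ⇒ the range strictly grows on every parameter interval
  (`strictGrowth_of_not_shadows`); with the arc range this forces injectivity by the argmax lemma
  `simple_of_arc_range_of_strictGrowth` (ideator 3's kernel-checked lemma, vendored verbatim);
  hence `mem_simple_of_arc_of_notMem_shadowEvent` and the composition `SimpleSubseqLimits_of`.

## Registered stubs (5; the only sorries of the file)

* `stub_rangeArc       : AvoidanceValues → RangeArc`                 (SHAPE transport, M–L, provable now)
* `stub_nearReturnBound : NearReturnBound`                          (lattice INPUT, open — hardest)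
* `stub_shadowChain    : NearReturnBound → ShadowDecayBdry`         (THE LEVER, L)
* `stub_rootReduction  : ShadowDecayBdry → ShadowDecay`             (interior roots, M–L)
* `stub_limitPassage   : ShadowDecay → NoShadowing`                 (portmanteau, M, provable now)

`SimpleSubseqLimits_of` (sorry-free) takes the five stub statements BY THEIR REGISTERED NAMES
(`Registered.stub_…`, the alias device of `Cruxes/BoundaryClosure/Lines/two-root-quotient.lean`)
together with the three ROUTE ITEMS `AvoidanceLimit` (stmt-10649, the route's rank-2 crux),
`AvoidancePassage` (stmt-4984) and `SLEAvoidanceValue` (stmt-10651) by name — admissible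
obligations of the skeleton audit — and concludes the crux decl BY NAME.  Honest reading: like
every line on this crux (triage S1: "S dissolves only relative to A"), the line proves
`SimpleSubseqLimits` from the avoidance crux of the route plus its own five stubs.

## Disproof used (`Cruxes/SimpleSubseqLimits/Disproof.lean`, cdisprove gen 1, and the landed
`Theorems/SimpleSubseqLimits/Negative/*`)

* §5 `crux_iff_core` = landed `Negative.simpleSubseqLimits_iff_core` and
  `ae_source_target_range_of_weakLimitAlong`: IMPORTED and used in `SimpleSubseqLimits_of`
  (endpoints / confinement are free; the line proves only simple ∧ boundary-avoiding).
* §2 `simpleSubseqLimits_false_without_tendsto_fst/snd`: both endpoint limits are used — through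
  the free clauses (source = a ≠ b = target gives the non-constant class needed for the light
  representative) and inside `stub_rangeArc` (SHAPE).
* §4 `simple_not_isClosed` / `exists_weakLimit_not_ae_simple`: no soft road — ORDER is a
  quantitative lattice input (NRB) passed to the limit on OPEN events (`nearShadowEvent`).
* §7 range-blindness (`exists_simple_and_not_simple_same_range`): exactly why ORDER is a separate
  path-level statement; `RangeArc` alone is not claimed to give simplicity.
* §9 criticality (`cruxAt_false_of_supercritical_limit`): every lattice statement is about
  `SAW.law` at `x_c`; NRB is false for `x > x_c` (space-filling walks return to their past),
  honoured by construction (barrier `SupercriticalSAWSpaceFilling*`).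
* §1/§10: junk laws (total mass 0) satisfy every lattice inequality trivially; no finite-mesh
  version of the carrier clause is asserted.
* negatives index (`ledger negatives --problem CriticalPhenomena`, 8 entries): none on simplicity;
  stmt-0772 (all-δ tightness) untouched — everything here is eventual in `δ`.
-/

noncomputable section

open MeasureTheory Filter Topology Set Metric Function
open Literature.Probability.RandomPlanarGeometry Literature.Probability.RandomPlanarGeometry.SAW
open Literature.Probability.LatticeModels
open scoped ENNReal NNReal BoundedContinuousFunction unitInterval

namespace Summit.CriticalPhenomena.SAWScalingLimit.Cruxes.SimpleSubseqLimits.PastShadowingCostsHalves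

open Summit.CriticalPhenomena.SAWScalingLimit.Theses.SAWLoopFugacityFlow
  (SimpleSubseqLimits AvoidanceLimit AvoidancePassage SLEAvoidanceValue)
open Summit.CriticalPhenomena.SAWScalingLimit.Theorems.SimpleSubseqLimits.Negative
  (WeakLimitAlong simpleSubseqLimits_iff_core ae_source_target_range_of_weakLimitAlong)

/-! ## §1 Limit-level statements -/

/-- **Hull-avoidance values of subsequential limits** (route-neutral form of the SHAPE input):
for every subsequential weak limit `ν` of the critical SAW laws along an endpoint approximation
there is a chordal SLE(8/3) law `μ` of `(D; a, b)` such that `ν` and `μ` give the same mass to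
`{range ⊆ closure D'}` for every hull subdomain `D'` (same marked points, agreeing with `D` in balls
around `a` and `b` — the inline form of the route items).  In route SAWLoopFugacityFlow /
SAWSteinDefect this is `AvoidanceLimit` + `AvoidancePassage` + `SLEAvoidanceValue`
(`avoidanceValues_of_routeItems`, proved below); SAWTensorRG / SAWFrontierHomotopy feed it from
their own avoidance cruxes. -/
def AvoidanceValues : Prop :=
  ∀ (D : DobrushinDomain) (a b : ℝ → Site 2), IsEndpointApprox D a b →
    ∀ (s : ℕ → ℝ) (ν : Measure (CurveClass ℂ)), Tendsto s atTop (𝓝[>] (0 : ℝ)) →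
      IsProbabilityMeasure ν → WeakLimitAlong D a b s ν →
        ∃ μ : Measure (CurveClass ℂ), IsSLELaw ((8 : ℝ≥0) / 3) D μ ∧
          ∀ D' : DobrushinDomain, D'.carrier ⊆ D.carrier → D'.pt 0 = D.pt 0 → D'.pt 1 = D.pt 1 →
            (∃ ε : ℝ, 0 < ε ∧ D'.carrier ∩ ball (D.pt 0) ε = D.carrier ∩ ball (D.pt 0) ε ∧
              D'.carrier ∩ ball (D.pt 1) ε = D.carrier ∩ ball (D.pt 1) ε) →
            ν (CurveClass.rangeSubset (closure D'.carrier)) =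
              μ (CurveClass.rangeSubset (closure D'.carrier))

/-- **SHAPE** (`RangeArc`): for every subsequential weak limit `ν`, `ν`-a.e. curve class has the
RANGE of a simple arc from `a = D.pt 0` to `b = D.pt 1` (an injective continuous `e : I → ℂ` with
`range e = range c`) and its range meets `∂D` only at `a, b`.  (Endpoints and `range ⊆ cl D` are
free: `Negative.ae_source_target_range_of_weakLimitAlong`.) -/
def RangeArc : Prop :=
  ∀ (D : DobrushinDomain) (a b : ℝ → Site 2), IsEndpointApprox D a b →
    ∀ (s : ℕ → ℝ) (ν : Measure (CurveClass ℂ)), Tendsto s atTop (𝓝[>] (0 : ℝ)) →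
      IsProbabilityMeasure ν → WeakLimitAlong D a b s ν →
        ∀ᵐ c ∂ν, (∃ e : C(I, ℂ), Injective e ∧ range e = c.range ∧ e 0 = D.pt 0 ∧ e 1 = D.pt 1) ∧
          c.range ∩ frontier D.carrier ⊆ {D.pt 0, D.pt 1}

/-- `γ` **`(η, ρ)`-shadows its own past**: after some time `s₀` it travels through a stretch
`[t, t']` of displacement `≥ η` every point of which was already visited before `s₀` at a point at
distance `≥ ρ` from `γ s₀` ("travelling along the own past outside the `ρ`-ball at the tip"). -/
def Shadows (γ : Curve ℂ) (η ρ : ℝ) : Prop :=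
  ∃ s₀ t t' : I, s₀ ≤ t ∧ t ≤ t' ∧ η ≤ dist (γ t) (γ t') ∧
    ∀ u : I, t ≤ u → u ≤ t' → γ u ∈ γ '' {v : I | v ≤ s₀ ∧ ρ ≤ dist (γ v) (γ s₀)}

/-- The event "some representative `(η, ρ)`-shadows its own past" on curve classes. -/
def shadowEvent (η ρ : ℝ) : Set (CurveClass ℂ) :=
  {c | ∃ γ : Curve ℂ, CurveClass.mk γ = c ∧ Shadows γ η ρ}

/-- Lattice-visible **`ε`-near shadowing**: after `s₀`, a stretch of displacement `> η` stays
within (open) distance `ε` of past points at distance `> ρ` from `γ s₀` (strict inequalities: an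
OPEN event, see `stub_limitPassage`). -/
def NearShadows (γ : Curve ℂ) (η ρ ε : ℝ) : Prop :=
  ∃ s₀ t t' : I, s₀ ≤ t ∧ t ≤ t' ∧ η < dist (γ t) (γ t') ∧
    ∀ u : I, t ≤ u → u ≤ t' → ∃ v : I, v ≤ s₀ ∧ ρ < dist (γ v) (γ s₀) ∧ dist (γ u) (γ v) < ε

/-- The event "some representative `ε`-nearly `(η, ρ)`-shadows its own past". -/
def nearShadowEvent (η ρ ε : ℝ) : Set (CurveClass ℂ) :=
  {c | ∃ γ : Curve ℂ, CurveClass.mk γ = c ∧ NearShadows γ η ρ ε}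

/-- **ORDER** (`NoShadowing`): every subsequential weak limit gives mass `0` to shadowing, for all
thresholds `η, ρ > 0`. True for measures carried by simple classes; fails on a Z-fold. -/
def NoShadowing : Prop :=
  ∀ (D : DobrushinDomain) (a b : ℝ → Site 2), IsEndpointApprox D a b →
    ∀ (s : ℕ → ℝ) (ν : Measure (CurveClass ℂ)), Tendsto s atTop (𝓝[>] (0 : ℝ)) →
      IsProbabilityMeasure ν → WeakLimitAlong D a b s ν →
        ∀ η ρ : ℝ, 0 < η → 0 < ρ → ν (shadowEvent η ρ) = 0

/-- **Discrete shadow decay at `(D; a_δ, b_δ)`**: for all thresholds `η, ρ` and every target `θ`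
there is a width `ε > 0` (depending on `D`: a domain with an `η`-long corridor of width `< ε`
forces near-shadowing, so NO domain-uniform version is true) such that for all small meshes the
critical SAW `ε`-nearly shadows an `η`-stretch of its `ρ`-far past with probability `≤ θ`.  The
chain gives the rate `θ = K(ε, ρ, D) · 2^{-c η / ε}`; only `θ → 0` is consumed. -/
def ShadowDecayAt (D : DobrushinDomain) (a b : ℝ → Site 2) : Prop :=
  ∀ η ρ θ : ℝ, 0 < η → 0 < ρ → 0 < θ → ∃ ε : ℝ, 0 < ε ∧
    ∀ᶠ δ in 𝓝[>] (0 : ℝ),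
      law D.carrier δ (a δ) (b δ) {γ | γ.curve ∈ nearShadowEvent η ρ ε} ≤ ENNReal.ofReal θ

/-- Shadow decay along EVERY endpoint approximation (interior lattice roots allowed). -/
def ShadowDecay : Prop :=
  ∀ (D : DobrushinDomain) (a b : ℝ → Site 2), IsEndpointApprox D a b → ShadowDecayAt D a b

/-- `u` is a **boundary root** of `Ω_δ`: some nearest-neighbour edge of `ℤ²` at `u` is NOT an edge
of `discreteDomainGraph Ω δ` (the closed segment leaves `Ω̄`, or the neighbour is off the discrete
domain).  Then the past of a walk started at `u` is attached to the exterior at graph level: the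
slit graphs have no floating island, a pocket containing the tip has a single exit, and the
thin-corridor-versus-wide-passage pathology of interior roots (triage F2) cannot occur. -/
def IsBoundaryRoot (Ω : Set ℂ) (δ : ℝ) (u : Site 2) : Prop :=
  ∃ w : Site 2, (zdGraph 2).Adj u w ∧ ¬ (discreteDomainGraph Ω δ).Adj u w

/-- Shadow decay along endpoint approximations whose START is eventually a boundary root (what the
chain delivers; interior roots are `stub_rootReduction`). -/
def ShadowDecayBdry : Prop :=
  ∀ (D : DobrushinDomain) (a b : ℝ → Site 2), IsEndpointApprox D a b →
    (∀ᶠ δ in 𝓝[>] (0 : ℝ), IsBoundaryRoot D.carrier δ (a δ)) → ShadowDecayAt D a b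

/-! ## §2 Lattice vocabulary: pasts, slit graphs, graph-level avoidability, the near-return bound -/

section Lattice

variable {Ω : Set ℂ} {δ : ℝ} {u v : Site 2}

/-- The vertices visited strictly before step `k` (the past WITHOUT the tip `γ_k`). -/
def pastVerts (γ : DomainSAW Ω δ u v) (k : ℕ) : Set (Site 2) :=
  {w | ∃ i : ℕ, i < k ∧ γ.walk.getVert i = w}

/-- `G` with the vertex set `P` deleted (the SLIT GRAPH `Ω_δ ∖ past` when `P = pastVerts γ k`). -/
def slitGraph (G : SimpleGraph (Site 2)) (P : Set (Site 2)) : SimpleGraph (Site 2) where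
  Adj x y := G.Adj x y ∧ x ∉ P ∧ y ∉ P
  symm := ⟨fun _ _ h => ⟨h.1.symm, h.2.2, h.2.1⟩⟩
  loopless := ⟨fun _ h => G.irrefl h.1⟩

/-- Lattice sites whose mesh points lie in the open annulus `A(z₀; r, R)`. -/
def annulusVerts (δ : ℝ) (z₀ : ℂ) (r R : ℝ) : Set (Site 2) :=
  {w | r < dist (meshPoint δ w) z₀ ∧ dist (meshPoint δ w) z₀ < R}

/-- The connected component of `w` inside the vertex set `S` of `G` (empty if `w ∉ S`). -/
def compIn (G : SimpleGraph (Site 2)) (S : Set (Site 2)) (w : Site 2) : Set (Site 2) :=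
  {x | ∃ (hw : w ∈ S) (hx : x ∈ S), (G.induce S).Reachable ⟨w, hw⟩ ⟨x, hx⟩}

/-- **Graph-level avoidability** (Kemppainen–Smirnov's `Aᵘ_τ` read on the slit graph `G`): `w ∈ S`
and deleting the whole component of `w` in `S` keeps the tip joined to the target in `G`. -/
def Avoidable (G : SimpleGraph (Site 2)) (tip tgt : Site 2) (S : Set (Site 2)) (w : Site 2) :
    Prop :=
  w ∈ S ∧ ∃ (ht : tip ∉ compIn G S w) (hb : tgt ∉ compIn G S w),
    (G.induce (compIn G S w)ᶜ).Reachable ⟨tip, ht⟩ ⟨tgt, hb⟩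

/-- After step `k` the walk makes an **unforced crossing of `A(z₀; r, R)` observed at time `k`**:
indices `k ≤ i < j`, one of the two vertices within `r` of `z₀`, the other beyond `R`, and every
intermediate vertex avoidable in the slit graph `Ω_δ ∖ γ[0, k)` with tip `γ_k` and target `v`
(KS 2017, Def. 2.3, on the lattice). -/
def FutureUnforcedCrossing (γ : DomainSAW Ω δ u v) (k : ℕ) (z₀ : ℂ) (r R : ℝ) : Prop :=
  ∃ i j : ℕ, k ≤ i ∧ i < j ∧ j ≤ γ.length ∧
    ((dist (meshPoint δ (γ.walk.getVert i)) z₀ ≤ r ∧ R ≤ dist (meshPoint δ (γ.walk.getVert j)) z₀) ∨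
      (R ≤ dist (meshPoint δ (γ.walk.getVert i)) z₀ ∧ dist (meshPoint δ (γ.walk.getVert j)) z₀ ≤ r)) ∧
    ∀ m : ℕ, i < m → m < j →
      Avoidable (slitGraph (discreteDomainGraph Ω δ) (pastVerts γ k)) (γ.walk.getVert k) v
        (annulusVerts δ z₀ r R) (γ.walk.getVert m)

/-- `S` is an event of the first `k` steps (`𝓕_k`-measurable set of pasts). -/
def IsPrefixEvent (k : ℕ) (S : Set (DomainSAW Ω δ u v)) : Prop :=
  ∀ γ γ' : DomainSAW Ω δ u v, (∀ i : ℕ, i ≤ k → γ.walk.getVert i = γ'.walk.getVert i) →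
    (γ ∈ S ↔ γ' ∈ S)

/-- NEAR-RETURN GEOMETRY at time `k`: the walk has at least `k` steps, the centre `z₀` is a point
of its past `γ[0, k]`, and the tip `γ_k` lies at distance `≥ R` from `z₀`. -/
def nearReturnPasts (k : ℕ) (z₀ : ℂ) (R : ℝ) : Set (DomainSAW Ω δ u v) :=
  {γ | k ≤ γ.length ∧ (∃ i : ℕ, i ≤ k ∧ meshPoint δ (γ.walk.getVert i) = z₀) ∧
    R ≤ dist (meshPoint δ (γ.walk.getVert k)) z₀}

end Lattice

/-- **NRB — the near-return bound** (the line's lattice INPUT; integrated conditional form, typed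
directly on `SAW.law`): there is `C > 1` such that for every Dobrushin domain, mesh `δ > 0`,
BOUNDARY-ROOTED start `u`, target `v`, time `k`, centre `z₀`, radii `δ ≤ r`, `C r ≤ R` with the
target at distance `≥ R` from `z₀`, and every `𝓕_k`-event `S` of pasts through `z₀` whose tip is
at distance `≥ R`: `P(S ∩ {unforced crossing of A(z₀; r, R) after k}) ≤ ½ · P(S)`.  These are
exactly the instances of Kemppainen–Smirnov's Condition G2 (arXiv:1212.6215 §2.1.3 eq. (16)) with
the annulus CENTRED ON THE PAST and observed from outside — the only ones the chain consumes; by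
the exact domain Markov property of the `x_c`-weighted law they are time-zero bounds (Condition G1,
eq. (4)) for critical SAW in slit graphs, i.e. the near-return instances of the live item
`SAWParafermion.KSAdmissibleG1` (stmt-CriticalPhenomena-11346) modulo cell-domain bookkeeping.
No technology proves it at `n = 0` (no FKG below `n = 1`); false for `x > x_c`. -/
def NearReturnBound : Prop :=
  ∃ C : ℝ, 1 < C ∧ ∀ (D : DobrushinDomain) (δ : ℝ) (u v : Site 2), 0 < δ →
    IsBoundaryRoot D.carrier δ u →
    ∀ (k : ℕ) (z₀ : ℂ) (r R : ℝ), δ ≤ r → C * r ≤ R → R ≤ dist (meshPoint δ v) z₀ →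
      ∀ S : Set (DomainSAW D.carrier δ u v), IsPrefixEvent k S →
        law D.carrier δ u v (S ∩ nearReturnPasts k z₀ R ∩ {γ | FutureUnforcedCrossing γ k z₀ r R}) ≤
          2⁻¹ * law D.carrier δ u v (S ∩ nearReturnPasts k z₀ R)

/-! ## §3 The five registered stubs (the only sorries of this file) -/

/-- **stub 1 — SHAPE transport (triage F5/S1; M–L, provable now).** From the hull-avoidance values:
first the boundary clause from THIN hulls shrinking to boundary segments `σ ∌ a, b` (values `→ 1` by
kernel continuity of `Φ'_·(0)`, `LSWConverges.tendsto_restrictionDeriv`); then exhaustion of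
boundary-attached compacta by hull super-domains (the family `{range ⊆ cl D'}` is not ∩-closed:
pass to `{range ∩ C = ∅}`), the two-sided fill `M* = cl D ∖ (U_L ∪ U_R)` is a measurable function of
countably many such indicators, `law_ν(M*) = law(SLE₈/₃ trace)` (a simple arc a.s.:
`IsSLELaw.ae_simple`, `sleCarrier_holds` of Disproof §3), and a connected range `∋ a, b` inside an
arc with the same ends IS the arc. -/
theorem stub_rangeArc : AvoidanceValues → RangeArc := by
  sorry

/-- **stub 2 — the lattice INPUT NRB (open; the hardest stub).** See `NearReturnBound`. -/
theorem stub_nearReturnBound : NearReturnBound := by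
  sorry

/-- **stub 3 — THE LEVER: the chain of halves (L).** For a boundary-rooted start: an `ε`-near
shadowing of an `η`-stretch of the `ρ`-far past forces `N ≍ η/(C² ε)` successive unforced inward
approaches within `2ε` of past-measurably designated past points `z_k` from distance `2Cε`
(rounds end at the arrival stopping times `τ_k`; both neighbours `z_{k±1}` at spacing `~3C²ε`
along the old past are designated `𝓕_{τ_k}`-measurably, so NO union bound over chains; starts are
anchored at `n`-th returns to a fixed `ε`-net annulus, whose expected number is `O(ε⁻²)`), each of
conditional probability `≤ ½` by NRB and the exact domain Markov property (KS arXiv:1212.6215,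
proof of Prop. 3.7, p. 16, and the nesting of p. 11); forced (sealed) approaches are not charged and
are paid for topologically (index bookkeeping of KS Lemma 3.6 type: a pocket of a boundary-rooted
slit domain has ONE exit).  Output `P_δ ≤ O(ε⁻²) 2^{-cη/(C²ε)} ≤ θ` for `ε ≤ ε₀(η, ρ, θ, D)` and
`δ ≤ δ₀(ε)`: `ShadowDecayBdry`. -/
theorem stub_shadowChain : NearReturnBound → ShadowDecayBdry := by
  sorry

/-- **stub 4 — interior lattice roots (triage F2/S2; M–L).** `IsEndpointApprox` lets `a_δ` sit at
mesoscopic depth; then the past floats and NRB-type bounds fail for rare pasts (thin corridor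
between the initial segment and `∂D`).  Reduce to boundary roots: e.g. LEASHES — for a thin closed
strip `L` from just beside `δ·a_δ` to `∂D` cutting the `ℤ²`-edges behind the root, `D ∖ L` is again
a Jordan domain in which `a_δ` IS a boundary root and, by the exact restriction identity of the
`x_c`-weights, `P_D(E ∩ {γ avoids L}) = (Z_{D∖L}/Z_D) · P_{D∖L}(E) ≤ P_{D∖L}(E)`; two leashes on
opposite sides leave the event `{γ crosses both}`, a lattice-scale winding around the own root whose
probability is to be shown `o(1)`; the chain bound must be re-run in the leashed domains (it only
uses NRB, which is stated for all Dobrushin domains).  Alternative: NRB outside a set of pasts of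
vanishing probability. -/
theorem stub_rootReduction : ShadowDecayBdry → ShadowDecay := by
  sorry

/-- **stub 5 — passage to the limit (M, provable now).** `shadowEvent η ρ ⊆ nearShadowEvent η' ρ' ε`
for `η' < η`, `ρ' < ρ`, every `ε > 0`; `nearShadowEvent` is OPEN in `CurveClass ℂ` (strict
inequalities, compactness of the stretch, reparametrisation invariance via `dist_mk_mk`); along the
sequence `s n → 0⁺` the honest laws converge weakly, so the portmanteau inequality for open sets
(`ν(G) ≤ liminf P_{s n}(G)`, Mathlib `MeasureTheory.le_liminf_measure_open_of_tendsto`-type lemmas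
on `ProbabilityMeasure`, cf. `Negative.ae_mem_of_isClosed_of_weakLimitAlong` for the closed twin)
and `ShadowDecay` give `ν(shadowEvent η ρ) ≤ θ` for every `θ > 0`. -/
theorem stub_limitPassage : ShadowDecay → NoShadowing := by
  sorry

/-! ## §4 Proved: the SHAPE input from the route items -/

/-- `ε`-ball agreement of `D'` with `D` at `p` keeps `p` off `closure (D ∖ D')` (the inline hull
condition of the route items implies `MarkedDomain.IsHullSubdomain`). [folklore] -/
theorem notMem_closure_diff_of_ball_eq {D D' : DobrushinDomain} {p : ℂ} {ε : ℝ} (hε : 0 < ε)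
    (h : D'.carrier ∩ ball p ε = D.carrier ∩ ball p ε) :
    p ∉ closure (D.carrier \ D'.carrier) := by
  rw [Metric.mem_closure_iff]
  push Not
  refine ⟨ε, hε, fun x hx => ?_⟩
  by_contra hlt
  push Not at hlt
  have hxball : x ∈ D.carrier ∩ ball p ε := ⟨hx.1, by rw [mem_ball, dist_comm]; exact hlt⟩
  rw [← h] at hxball
  exact hx.2 hxball.1

/-- **The route delivers `AvoidanceValues`**: `AvoidanceLimit` (stmt-10649) gives the lattice
hull-avoidance limits `Φ'_A(0)^{5/8}` for the pulled-back `*`-hulls (chordal uniformizer by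
`MarkedDomain.exists_isChordalUniformizing_holds`, `IsStarHull.pullbackHull`, restriction data by
`IsStarHull.existsUnique_isRestrictionMap_holds` / `exists_hasRestrictionDeriv_holds` — all
THEOREMS), `SLEAvoidanceValue` (stmt-10651) identifies that value as the SLE(8/3) avoidance
probability (SLE law from `exists_isSLECurve_eightThirds`), and `AvoidancePassage` (stmt-4984)
sandwiches the limit `ν`. [folklore] -/
theorem avoidanceValues_of_routeItems (hA : AvoidanceLimit) (hP : AvoidancePassage)
    (hV : SLEAvoidanceValue) : AvoidanceValues := by
  intro D a b hab s ν hs hν hw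
  obtain ⟨Γ, hΓ⟩ := exists_isSLECurve_eightThirds D
  refine ⟨_, hΓ.isSLELaw_map, fun D' hsub h0 h1 hε => ?_⟩
  refine hP D a b hab s ν _ hs hν hw hΓ.isSLELaw_map ?_ D' hsub h0 h1 hε
  intro D'' hsub'' h0'' h1'' hε''
  obtain ⟨ε, hεpos, hb0, hb1⟩ := hε''
  obtain ⟨φ, hφ⟩ := MarkedDomain.exists_isChordalUniformizing_holds D
  have hHS : D.IsHullSubdomain D'' :=
    ⟨hsub'', h0'', h1'', notMem_closure_diff_of_ball_eq hεpos hb0,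
      notMem_closure_diff_of_ball_eq hεpos hb1⟩
  have hstar : IsStarHull (φ.pullbackHull D'') :=
    IsStarHull.pullbackHull JordanDomain.isSimplyConnected_holds hφ hHS
  obtain ⟨Φ, hΦ, -⟩ := IsStarHull.existsUnique_isRestrictionMap_holds hstar
  obtain ⟨d, -, -, hd⟩ := IsStarHull.exists_hasRestrictionDeriv_holds hstar hΦ
  have hlim := hA D D'' a b hab hsub'' h0'' h1'' ⟨ε, hεpos, hb0, hb1⟩ φ hφ (φ.pullbackHull D'')
    rfl Φ d hΦ hd
  have hval := hV D D'' _ hΓ.isSLELaw_map hsub'' h0'' h1'' ⟨ε, hεpos, hb0, hb1⟩ φ hφ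
    (φ.pullbackHull D'') rfl Φ d hΦ hd
  rw [hval]
  exact hlim.comp hs

/-! ## §5 Proved: the deterministic glue SHAPE + ORDER ⇒ simple -/

/-- **Argmax lemma** (ideator 3's `simple_of_arc_range_of_strictGrowth`, crux-ideate r1, kernel-
checked there and by triage r1-3 `CheckI3.lean`; vendored verbatim): if the range of `γ` is a simple
arc `e` with the same endpoints and the range STRICTLY GROWS on every nondegenerate parameter
interval, then `γ` is injective, so its class is simple (`f = e⁻¹ ∘ γ`; a dip of `f` below an
earlier maximum contradicts growth via the intermediate value theorem). [folklore] -/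
theorem simple_of_arc_range_of_strictGrowth (γ : Curve ℂ) (e : C(unitInterval, ℂ))
    (he : Function.Injective e) (hrange : Set.range e = γ.range)
    (h0 : e 0 = γ 0) (h1 : e 1 = γ 1)
    (hgrow : ∀ s t : unitInterval, s < t → ¬ (γ '' Set.Icc s t ⊆ γ '' Set.Icc 0 s)) :
    CurveClass.mk γ ∈ CurveClass.simple := by
  classical
  have _h1 := h1
  have hmem : ∀ t, γ t ∈ Set.range e := fun t => by rw [hrange]; exact ⟨t, rfl⟩
  let E : unitInterval ≃ Set.range e := Equiv.ofInjective e he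
  have hEcont : Continuous E := continuous_induced_rng.2 e.continuous
  have hEsymm : Continuous E.symm := Continuous.continuous_symm_of_equiv_compact_to_t2 hEcont
  let f : unitInterval → unitInterval := fun t => E.symm ⟨γ t, hmem t⟩
  have hγc : Continuous fun t : unitInterval => (⟨γ t, hmem t⟩ : Set.range e) :=
    continuous_induced_rng.2 γ.continuous
  have hf : Continuous f := hEsymm.comp hγc
  have hef : ∀ t, e (f t) = γ t := by
    intro t
    have h : ((E (f t) : Set.range e) : ℂ) = γ t := by
      show ((E (E.symm ⟨γ t, hmem t⟩) : Set.range e) : ℂ) = γ t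
      rw [Equiv.apply_symm_apply]
    rw [← h]
    rfl
  have hf0 : f 0 = 0 := he ((hef 0).trans h0.symm)
  -- real-valued copy of `f` and its extension to `ℝ` for the intermediate value theorem
  let F : unitInterval → ℝ := fun t => (f t : ℝ)
  have hF : Continuous F := continuous_subtype_val.comp hf
  let FR : ℝ → ℝ := F ∘ Set.projIcc (0 : ℝ) 1 zero_le_one
  have hFR : Continuous FR := hF.comp continuous_projIcc
  -- the key step: a point `ts < t₂` dominating `f` on `[0, t₂]` contradicts strict growth
  have key : ∀ ts t₂ : unitInterval, ts < t₂ → (∀ t : unitInterval, t ≤ t₂ → F t ≤ F ts) →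
      False := by
    intro ts t₂ hts hdom
    apply hgrow ts t₂ hts
    rintro _ ⟨t, ⟨hst, htt⟩, rfl⟩
    have hle : F t ≤ F ts := hdom t htt
    have hge : F 0 ≤ F t := by
      show ((f 0 : unitInterval) : ℝ) ≤ (f t : ℝ)
      rw [hf0]; exact (f t).2.1
    -- IVT for `FR` on `[0, ts]`
    have hts0 : (0 : ℝ) ≤ (ts : ℝ) := ts.2.1
    have hIVT := intermediate_value_Icc hts0 hFR.continuousOn
    have hFR0 : FR 0 = F 0 := by
      show F (Set.projIcc 0 1 zero_le_one 0) = F 0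
      rw [Set.projIcc_left]; rfl
    have hFRts : FR ts = F ts := by
      show F (Set.projIcc 0 1 zero_le_one (ts : ℝ)) = F ts
      rw [Set.projIcc_val]
    have hmemI : F t ∈ Set.Icc (FR 0) (FR ts) := by
      rw [hFR0, hFRts]; exact ⟨hge, hle⟩
    obtain ⟨x, hx, hxval⟩ := hIVT hmemI
    have hx01 : x ∈ Set.Icc (0 : ℝ) 1 := ⟨hx.1, hx.2.trans ts.2.2⟩
    set s : unitInterval := Set.projIcc 0 1 zero_le_one x with hs
    have hsx : (s : ℝ) = x := by rw [hs, Set.projIcc_of_mem _ hx01]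
    have hfs : f s = f t := by
      apply Subtype.ext
      show F s = F t
      have : FR x = F s := rfl
      rw [← this, hxval]
    refine ⟨s, ⟨bot_le, ?_⟩, ?_⟩
    · show (s : ℝ) ≤ (ts : ℝ)
      rw [hsx]; exact hx.2
    · rw [← hef, hfs, hef]
  have hmono : StrictMono f := by
    intro t₁ t₂ hlt
    by_contra hnot
    have hle : f t₂ ≤ f t₁ := not_lt.1 hnot
    have hS : IsClosed {t : unitInterval | (t : ℝ) ≤ (t₂ : ℝ)} :=
      isClosed_le continuous_subtype_val continuous_const
    obtain ⟨tm, htm, hmax⟩ :=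
      hS.isCompact.exists_isMaxOn ⟨t₂, show ((t₂ : unitInterval) : ℝ) ≤ t₂ from le_rfl⟩
        hF.continuousOn
    have htm' : tm ≤ t₂ := htm
    by_cases hlt2 : tm < t₂
    · exact key tm t₂ hlt2 (fun t ht => hmax (show ((t : unitInterval) : ℝ) ≤ t₂ from ht))
    · have htm2 : tm = t₂ := le_antisymm htm' (not_lt.1 hlt2)
      refine key t₁ t₂ hlt (fun t ht => ?_)
      have h1' : F t ≤ F tm := hmax (show ((t : unitInterval) : ℝ) ≤ t₂ from ht)
      have h2' : F t₂ ≤ F t₁ := by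
        show ((f t₂ : unitInterval) : ℝ) ≤ (f t₁ : ℝ)
        exact_mod_cast hle
      calc F t ≤ F tm := h1'
        _ = F t₂ := by rw [htm2]
        _ ≤ F t₁ := h2'
  have hinj : Function.Injective γ := by
    intro a b hab
    apply hmono.injective
    apply he
    rw [hef, hef]; exact hab
  exact CurveClass.mk_mem_simple hinj

/-- **No shadowing ⇒ strict range growth** for a LIGHT curve (no interval of constancy): if
`γ '' [s, t] ⊆ γ '' [0, s]` with `s < t`, lightness gives `u ∈ (s, t]` with `γ u ≠ γ s`; near `u`
the curve stays at distance `> d/2` from `γ s` (`d = |γ u - γ s|`), lightness again gives a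
sub-stretch of positive displacement there, and every point of it is a past point (`≤ s`) far from
`γ s` — an `(η, ρ)`-shadowing with `η, ρ ≥ 1/(k+1)` for some `k`. [folklore] -/
theorem strictGrowth_of_not_shadows (γ : Curve ℂ)
    (hlight : ∀ s t : I, s < t → ∃ u, s ≤ u ∧ u ≤ t ∧ γ u ≠ γ s)
    (hns : ∀ k : ℕ, ¬ Shadows γ (1 / ((k : ℝ) + 1)) (1 / ((k : ℝ) + 1))) :
    ∀ s t : I, s < t → ¬ (γ '' Set.Icc s t ⊆ γ '' Set.Icc 0 s) := by
  intro s t hst hsub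
  obtain ⟨u, hsu, hut, hne⟩ := hlight s t hst
  have hsu' : s < u := lt_of_le_of_ne hsu (fun h => hne (congrArg γ h).symm)
  set d : ℝ := dist (γ u) (γ s) with hd
  have hdpos : 0 < d := dist_pos.2 hne
  -- near `u` the curve stays far from `γ s`
  have hcont : ContinuousAt (fun x : I => dist (γ x) (γ s)) u :=
    (γ.continuous.dist continuous_const).continuousAt
  obtain ⟨τ, hτ, hτd⟩ : ∃ τ > 0, ∀ x : I, dist x u < τ → d / 2 < dist (γ x) (γ s) := by
    have hlt : d / 2 < dist (γ u) (γ s) := by rw [← hd]; linarith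
    have hev : ∀ᶠ x in 𝓝 u, d / 2 < dist (γ x) (γ s) := hcont.eventually (lt_mem_nhds hlt)
    obtain ⟨τ, hτ, hball⟩ := Metric.eventually_nhds_iff.1 hev
    exact ⟨τ, hτ, fun x hx => hball hx⟩
  -- the left end `u₁ = max s (u - τ/2)` of a short parameter interval ending at `u`
  have hsuR : (s : ℝ) < (u : ℝ) := Subtype.coe_lt_coe.2 hsu'
  have hu1mem : max (s : ℝ) ((u : ℝ) - τ / 2) ∈ Set.Icc (0 : ℝ) 1 :=
    ⟨le_max_of_le_left s.2.1, max_le s.2.2 (by linarith [u.2.2])⟩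
  set u₁ : I := ⟨max (s : ℝ) ((u : ℝ) - τ / 2), hu1mem⟩ with hu₁
  have hsu1 : s ≤ u₁ := Subtype.coe_le_coe.1 (le_max_left _ _)
  have hu1u : u₁ < u := Subtype.coe_lt_coe.1 (max_lt hsuR (by linarith))
  have hclose : ∀ x : I, u₁ ≤ x → x ≤ u → dist x u < τ := by
    intro x hx1 hx2
    have h1 : (u : ℝ) - τ / 2 ≤ (x : ℝ) := (le_max_right _ _).trans (Subtype.coe_le_coe.2 hx1)
    have h2 : (x : ℝ) ≤ (u : ℝ) := Subtype.coe_le_coe.2 hx2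
    rw [Subtype.dist_eq, Real.dist_eq, abs_sub_lt_iff]
    constructor <;> linarith
  -- lightness on `[u₁, u]`: a sub-stretch of positive displacement
  obtain ⟨w, hu1w, hwu, hwne⟩ := hlight u₁ u hu1u
  have hη₀ : 0 < dist (γ u₁) (γ w) := dist_pos.2 (Ne.symm hwne)
  obtain ⟨k, hk⟩ := exists_nat_one_div_lt (lt_min hη₀ (half_pos hdpos))
  apply hns k
  refine ⟨s, u₁, w, hsu1, hu1w, (hk.trans_le (min_le_left _ _)).le, ?_⟩
  intro x hx1 hx2
  have hxI : x ∈ Set.Icc s t := ⟨hsu1.trans hx1, hx2.trans (hwu.trans hut)⟩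
  obtain ⟨y, hy, hyx⟩ := hsub ⟨x, hxI, rfl⟩
  refine ⟨y, ⟨hy.2, ?_⟩, hyx⟩
  have hfar : d / 2 < dist (γ x) (γ s) := hτd x (hclose x hx1 (hx2.trans hwu))
  rw [hyx]
  exact ((hk.trans_le (min_le_right _ _)).trans hfar).le

/-- **SHAPE + ORDER ⇒ simple, for one class**: a class whose range is a simple arc with the same
endpoints and none of whose representatives `(1/(k+1), 1/(k+1))`-shadows its past (all `k`) is
simple — light representative (`Curve.exists_light_of_ne`, the class is non-constant because
`e 0 ≠ e 1`), strict growth (`strictGrowth_of_not_shadows`), argmax lemma. [folklore] -/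
theorem mem_simple_of_arc_of_notMem_shadowEvent (c : CurveClass ℂ) (e : C(I, ℂ))
    (he : Injective e) (hrange : range e = c.range) (h0 : e 0 = c.source) (h1 : e 1 = c.target)
    (hns : ∀ k : ℕ, c ∉ shadowEvent (1 / ((k : ℝ) + 1)) (1 / ((k : ℝ) + 1))) :
    c ∈ CurveClass.simple := by
  obtain ⟨γ₀, rfl⟩ := CurveClass.surjective_mk c
  have h01 : γ₀ 0 ≠ γ₀ 1 := by
    intro h
    have he01 : e 0 = e 1 := by
      rw [h0, h1, CurveClass.source_mk, CurveClass.target_mk, Curve.source_def, Curve.target_def]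
      exact h
    have h01' : ((0 : I) : ℝ) = ((1 : I) : ℝ) := congrArg Subtype.val (he he01)
    norm_num at h01'
  obtain ⟨γ, hγc, hγ0, hγ1, hlight, -⟩ := Curve.exists_light_of_ne h01
  have hnsγ : ∀ k : ℕ, ¬ Shadows γ (1 / ((k : ℝ) + 1)) (1 / ((k : ℝ) + 1)) :=
    fun k hk => hns k ⟨γ, hγc, hk⟩
  have hgrow := strictGrowth_of_not_shadows γ hlight hnsγ
  rw [← hγc]
  refine simple_of_arc_range_of_strictGrowth γ e he ?_ ?_ ?_ hgrow
  · rw [hrange, ← hγc, CurveClass.range_mk]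
  · rw [h0, CurveClass.source_mk, Curve.source_def, hγ0]
  · rw [h1, CurveClass.target_mk, Curve.target_def, hγ1]

/-! ## §6 The kernel-checked composition -/

/-! ### Name-keyed aliases of the five stub statements (hypotheses of the composition)

`Registered.stub_X` is the statement of `stub_X` under the registered stub's short name, so that the
native skeleton audit (`#h21_check_skeleton`: hypotheses admissible iff registered obligations —
route items / declared stubs — BY NAME) accepts `SimpleSubseqLimits_of` (same device as
`Cruxes/BoundaryClosure/Lines/two-root-quotient.lean`). -/
namespace Registered

/-- Alias keyed by the registered stub name. -/
abbrev stub_rangeArc : Prop := AvoidanceValues → RangeArc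
/-- Alias keyed by the registered stub name. -/
abbrev stub_nearReturnBound : Prop := NearReturnBound
/-- Alias keyed by the registered stub name. -/
abbrev stub_shadowChain : Prop := NearReturnBound → ShadowDecayBdry
/-- Alias keyed by the registered stub name. -/
abbrev stub_rootReduction : Prop := ShadowDecayBdry → ShadowDecay
/-- Alias keyed by the registered stub name. -/
abbrev stub_limitPassage : Prop := ShadowDecay → NoShadowing

end Registered

/-- **The line concludes the crux BY NAME** (`<Crux>_of`, sorry-free; axioms propext /
Classical.choice / Quot.sound).  Hypotheses: the five registered stub statements and the three
route items `AvoidanceLimit` (stmt-10649), `AvoidancePassage` (stmt-4984), `SLEAvoidanceValue`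
(stmt-10651) by name.  ORDER: stubs 2 → 3 → 4 → 5 give `NoShadowing`; SHAPE: the route items give
`AvoidanceValues` (`avoidanceValues_of_routeItems`), stub 1 gives `RangeArc`; the landed core
equivalence reduces the crux to `ν`-a.s. simple ∧ boundary-avoiding; the boundary clause is in
`RangeArc`, and simplicity is `mem_simple_of_arc_of_notMem_shadowEvent` applied `ν`-a.e. (countably
many null shadow events, free endpoint clauses for `e 0 = source`, `e 1 = target`). -/
theorem SimpleSubseqLimits_of (h₁ : Registered.stub_rangeArc) (h₂ : Registered.stub_nearReturnBound)
    (h₃ : Registered.stub_shadowChain) (h₄ : Registered.stub_rootReduction)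
    (h₅ : Registered.stub_limitPassage)
    (hA : AvoidanceLimit) (hP : AvoidancePassage) (hV : SLEAvoidanceValue) :
    Summit.CriticalPhenomena.SAWScalingLimit.Theses.SAWLoopFugacityFlow.SimpleSubseqLimits := by
  have hNS : NoShadowing := h₅ (h₄ (h₃ h₂))
  have hRA : RangeArc := h₁ (avoidanceValues_of_routeItems hA hP hV)
  refine simpleSubseqLimits_iff_core.2 fun D a b hab s ν hs hν hw => ?_
  have hra := hRA D a b hab s ν hs hν hw
  have hfree := ae_source_target_range_of_weakLimitAlong hab hs hw
  have hns : ∀ k : ℕ, ∀ᵐ c ∂ν, c ∉ shadowEvent (1 / ((k : ℝ) + 1)) (1 / ((k : ℝ) + 1)) :=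
    fun k => measure_eq_zero_iff_ae_notMem.1
      (hNS D a b hab s ν hs hν hw _ _ (by positivity) (by positivity))
  rw [← ae_all_iff] at hns
  filter_upwards [hra, hfree, hns] with c hc hf hn
  obtain ⟨⟨e, he, hrange, he0, he1⟩, hfr⟩ := hc
  exact ⟨mem_simple_of_arc_of_notMem_shadowEvent c e he hrange (he0.trans hf.1.symm)
    (he1.trans hf.2.1.symm) hn, hfr⟩

/-- Wiring check: the registered stubs feed `SimpleSubseqLimits_of` as stated (the proof of the
item modulo the five stubs and the three route items). -/
example (hA : AvoidanceLimit) (hP : AvoidancePassage) (hV : SLEAvoidanceValue) :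
    Summit.CriticalPhenomena.SAWScalingLimit.Theses.SAWLoopFugacityFlow.SimpleSubseqLimits :=
  SimpleSubseqLimits_of stub_rangeArc stub_nearReturnBound stub_shadowChain stub_rootReduction
    stub_limitPassage hA hP hV

end Summit.CriticalPhenomena.SAWScalingLimit.Cruxes.SimpleSubseqLimits.PastShadowingCostsHalves

end
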